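import Mathlib
import HarnessLib
import Summits.ResolutionOfSingularities.ResolutionOfSingularities.Theorems.WildQuotientsWildQuotientResolutionS1aHypersurfaceK1

/-!
# S1a — R4c cusp, brick (b2′): the two JACOBIAN CERTIFICATES — the binomial `X₂′² − X₁′³` (O-side member) and the implicit graph `T′` (Q-side member)

[OURS · L1 W4.5c · lead-1 g17; plan-1 RULING R-F15v (2) ★ R4c `cusp_killsIn_two`, SPEC `Cruxes/CyclicQuotientFourfolds/Lines/s1a_logminvertex-R4c-SPEC.md` §2 (2O), (2Q), §3 (b2):
instances of ✓`FreeModel.isRegular_away_X_hypersurface`] — NOT statements of the manuscript; counted 0; AI-level work, weaker than expert review.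
Crux stmt-ResolutionOfSingularities-17941 `CyclicQuotientFourfolds`, line `s1a-logminvertex` v13 (`stub_reachLowerInFX`).

* ★ `FreeModel.isRegular_away_X_binomial23` — K1′ of `(x_{v₀}, x_{v₂}² − x_{v₁}³)` in `k[x_ι][1/h]` (char `≠ 2`) when `x_{v₂} ∉ Q` for every prime `Q ∋ x_{v₀}` off `V(h)`
  (certificate `∂/∂x_{v₂} = 2x_{v₂}`), given a `k`-point;
* ★ `FreeModel.isRegular_away_X_cuspGraphQ` — K1′ of `(X₀′, T′)`, `T′ = s²V′² + 2sV′Y′ + 2c·V′ + (1 − 3a)Y′² − sY′³` the `Q`-side chart tail of the cusp, in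
  `k[s, X₀′, Y′, V′, x₃][1/h]` (char `≠ 2`) when `c + sY′ + s²V′ (= π^*x₂) ∉ Q` for every prime `Q ∋ X₀′` off `V(h)` (certificate `∂T′/∂V′ = 2(c + sY′ + s²V′)`).
-/

set_option linter.dupNamespace false

noncomputable section

open MvPolynomial
open Literature.AlgebraicGeometry.Resolution

namespace Summit.ResolutionOfSingularities.ResolutionOfSingularities.Theorems.WildQuotientResolution.S1.FreeModel

variable {k : Type} [Field k] {ι : Type}

/-- A prime ideal containing `C u · x` with `u ≠ 0` contains `x`. -/
theorem mem_of_C_mul_mem {Q : Ideal (MvPolynomial ι k)} [hQ : Q.IsPrime] {u : k} (hu : u ≠ 0) {x : MvPolynomial ι k} (h : C u * x ∈ Q) : x ∈ Q := by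
  rcases hQ.mem_or_mem h with hC | hx
  · exact absurd (Q.eq_top_of_isUnit_mem hC ((IsUnit.mk0 u hu).map C)) hQ.ne_top
  · exact hx

set_option maxHeartbeats 1600000 in
/-- ★ **K1′ OF THE BINOMIAL MEMBER `(x_{v₀}, x_{v₂}² − x_{v₁}³)` in `k[x_ι][1/h]`** (characteristic `≠ 2`): if `x_{v₂} ∉ Q` for every prime `Q ∋ x_{v₀}` with `h ∉ Q`
(e.g. a norm `∏ₗ(x_{v₂} + l·s^e x_{v₀})` divides `h`) and `V(x_{v₀}, x_{v₂}² − x_{v₁}³) ∩ D(h)` has a `k`-point, then the pair is a regular sequence with regular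
quotient ring (Jacobian certificate `∂/∂x_{v₂} = 2x_{v₂}`). [OURS · L1 W4.5c · R4c brick (b2′), `O`-side member; NOT a statement of the manuscript] -/
theorem isRegular_away_X_binomial23 [Finite ι] (hh : MvPolynomial ι k) (v₀ v₁ v₂ : ι) (h10 : v₁ ≠ v₀) (h20 : v₂ ≠ v₀) (h12 : v₁ ≠ v₂) (h2 : (2 : k) ≠ 0)
    (hX2 : ∀ Q : Ideal (MvPolynomial ι k), Q.IsPrime → (X v₀ : MvPolynomial ι k) ∈ Q → hh ∉ Q → (X v₂ : MvPolynomial ι k) ∉ Q)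
    (pt : ι → k) (hpt0 : pt v₀ = 0) (hpt : pt v₂ ^ 2 = pt v₁ ^ 3) (hu : MvPolynomial.eval pt hh ≠ 0) :
    RingTheory.Sequence.IsRegular (Localization.Away hh)
        (List.ofFn (![algebraMap (MvPolynomial ι k) (Localization.Away hh) (X v₀),
          algebraMap (MvPolynomial ι k) (Localization.Away hh) (X v₂ ^ 2 - X v₁ ^ 3)] : Fin 2 → Localization.Away hh)) ∧
      IsRegularRing (Localization.Away hh ⧸ Ideal.span (Set.range
        (![algebraMap (MvPolynomial ι k) (Localization.Away hh) (X v₀),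
          algebraMap (MvPolynomial ι k) (Localization.Away hh) (X v₂ ^ 2 - X v₁ ^ 3)] : Fin 2 → Localization.Away hh))) := by
  classical
  have h1m : v₁ ∉ ({v₀} : Set ι) := by simpa using h10
  have h2m : v₂ ∉ ({v₀} : Set ι) := by simpa using h20
  let φ₀ : MvPolynomial {j : ι // j ∉ ({v₀} : Set ι)} k := X ⟨v₂, h2m⟩ ^ 2 - X ⟨v₁, h1m⟩ ^ 3
  have hren : rename ((↑) : {j : ι // j ∉ ({v₀} : Set ι)} → ι) φ₀ = X v₂ ^ 2 - X v₁ ^ 3 := by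
    simp only [φ₀, map_sub, map_pow, rename_X]
  have hne : (⟨v₁, h1m⟩ : {j : ι // j ∉ ({v₀} : Set ι)}) ≠ ⟨v₂, h2m⟩ := fun h => h12 (congrArg Subtype.val h)
  have two_eq : (2 : MvPolynomial {j : ι // j ∉ ({v₀} : Set ι)} k) = C 2 := (map_ofNat C 2).symm
  have hpd : rename ((↑) : {j : ι // j ∉ ({v₀} : Set ι)} → ι) (pderiv ⟨v₂, h2m⟩ φ₀) = C (2 : k) * X v₂ := by
    have e1 : pderiv ⟨v₂, h2m⟩ φ₀ = C (2 : k) * X ⟨v₂, h2m⟩ := by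
      simp only [φ₀, map_sub, pderiv_pow, pderiv_X_self, pderiv_X_of_ne hne, mul_one, mul_zero, sub_zero, Nat.cast_ofNat, two_eq]
      ring
    rw [e1, map_mul, rename_C, rename_X]
  have h := isRegular_away_X_hypersurface hh v₀ φ₀ (fun Q hQ hX0 _ hhQ => ⟨⟨v₂, h2m⟩, fun hm => ?_⟩) pt hpt0
    (by rw [hren, map_sub, map_pow, map_pow, MvPolynomial.eval_X, MvPolynomial.eval_X, hpt, sub_self]) hu
  · rwa [hren] at h
  · rw [hpd] at hm
    exact hX2 Q hQ hX0 hhQ (mem_of_C_mul_mem h2 hm)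

set_option maxHeartbeats 1600000 in
/-- ★ **K1′ OF THE `Q`-SIDE IMPLICIT-GRAPH MEMBER `(X₀′, T′)`**, `T′ = s²V′² + 2sV′Y′ + 2c·V′ + (1 − 3a)Y′² − sY′³` (`s = x_none`, `X₀′, Y′, V′ = x₀, x₁, x₂`),
in `k[s, x′][1/h]` (characteristic `≠ 2`): if `c + sY′ + s²V′ ∉ Q` (this is `π^*x₂` on the chart) for every prime `Q ∋ X₀′` with `h ∉ Q` and `V(X₀′, T′) ∩ D(h)` has a
`k`-point, then the pair is a regular sequence with regular quotient ring (Jacobian certificate `∂T′/∂V′ = 2(c + sY′ + s²V′)`). [OURS · L1 W4.5c · R4c brick (b2′),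
`Q`-side member; NOT a statement of the manuscript] -/
theorem isRegular_away_X_cuspGraphQ (hh : MvPolynomial (Option (Fin 4)) k) (a c : k) (h2 : (2 : k) ≠ 0)
    (hD : ∀ Q : Ideal (MvPolynomial (Option (Fin 4)) k), Q.IsPrime → (X (some 0) : MvPolynomial (Option (Fin 4)) k) ∈ Q → hh ∉ Q →
      (C c + X none * X (some 1) + X none ^ 2 * X (some 2) : MvPolynomial (Option (Fin 4)) k) ∉ Q)
    (pt : Option (Fin 4) → k) (hpt0 : pt (some 0) = 0)
    (hpt : pt none ^ 2 * pt (some 2) ^ 2 + 2 * pt none * pt (some 2) * pt (some 1) + 2 * c * pt (some 2) + (1 - 3 * a) * pt (some 1) ^ 2 -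
      pt none * pt (some 1) ^ 3 = 0)
    (hu : MvPolynomial.eval pt hh ≠ 0) :
    RingTheory.Sequence.IsRegular (Localization.Away hh)
        (List.ofFn (![algebraMap (MvPolynomial (Option (Fin 4)) k) (Localization.Away hh) (X (some 0)),
          algebraMap (MvPolynomial (Option (Fin 4)) k) (Localization.Away hh)
            (X none ^ 2 * X (some 2) ^ 2 + 2 * X none * X (some 2) * X (some 1) + C (2 * c) * X (some 2) + C (1 - 3 * a) * X (some 1) ^ 2 -
              X none * X (some 1) ^ 3)] : Fin 2 → Localization.Away hh)) ∧
      IsRegularRing (Localization.Away hh ⧸ Ideal.span (Set.range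
        (![algebraMap (MvPolynomial (Option (Fin 4)) k) (Localization.Away hh) (X (some 0)),
          algebraMap (MvPolynomial (Option (Fin 4)) k) (Localization.Away hh)
            (X none ^ 2 * X (some 2) ^ 2 + 2 * X none * X (some 2) * X (some 1) + C (2 * c) * X (some 2) + C (1 - 3 * a) * X (some 1) ^ 2 -
              X none * X (some 1) ^ 3)] : Fin 2 → Localization.Away hh))) := by
  classical
  have hn : (none : Option (Fin 4)) ∉ ({some 0} : Set (Option (Fin 4))) := by simp
  have h1 : (some 1 : Option (Fin 4)) ∉ ({some 0} : Set (Option (Fin 4))) := by simp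
  have h2' : (some 2 : Option (Fin 4)) ∉ ({some 0} : Set (Option (Fin 4))) := by simp
  let φ₀ : MvPolynomial {j : Option (Fin 4) // j ∉ ({some 0} : Set (Option (Fin 4)))} k :=
    X ⟨none, hn⟩ ^ 2 * X ⟨some 2, h2'⟩ ^ 2 + C 2 * X ⟨none, hn⟩ * X ⟨some 2, h2'⟩ * X ⟨some 1, h1⟩ + C (2 * c) * X ⟨some 2, h2'⟩ +
      C (1 - 3 * a) * X ⟨some 1, h1⟩ ^ 2 - X ⟨none, hn⟩ * X ⟨some 1, h1⟩ ^ 3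
  have hren : rename ((↑) : {j : Option (Fin 4) // j ∉ ({some 0} : Set (Option (Fin 4)))} → Option (Fin 4)) φ₀ =
      X none ^ 2 * X (some 2) ^ 2 + 2 * X none * X (some 2) * X (some 1) + C (2 * c) * X (some 2) + C (1 - 3 * a) * X (some 1) ^ 2 - X none * X (some 1) ^ 3 := by
    simp only [φ₀, map_sub, map_add, map_mul, map_pow, rename_X, rename_C, map_ofNat]
  have two_eq : (2 : MvPolynomial {j : Option (Fin 4) // j ∉ ({some 0} : Set (Option (Fin 4)))} k) = C 2 := (map_ofNat C 2).symm
  have hne1 : (⟨some 1, h1⟩ : {j : Option (Fin 4) // j ∉ ({some 0} : Set (Option (Fin 4)))}) ≠ ⟨some 2, h2'⟩ := fun h => by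
    simpa using congrArg Subtype.val h
  have hnen : (⟨none, hn⟩ : {j : Option (Fin 4) // j ∉ ({some 0} : Set (Option (Fin 4)))}) ≠ ⟨some 2, h2'⟩ := fun h => by
    simpa using congrArg Subtype.val h
  have hpd : rename ((↑) : {j : Option (Fin 4) // j ∉ ({some 0} : Set (Option (Fin 4)))} → Option (Fin 4)) (pderiv ⟨some 2, h2'⟩ φ₀) =
      C (2 : k) * (C c + X none * X (some 1) + X none ^ 2 * X (some 2)) := by
    have e1 : pderiv ⟨some 2, h2'⟩ φ₀ = C (2 : k) * (X ⟨none, hn⟩ ^ 2 * X ⟨some 2, h2'⟩ + X ⟨none, hn⟩ * X ⟨some 1, h1⟩) + C (2 * c) := by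
      simp only [φ₀, map_sub, map_add, pderiv_mul, pderiv_pow, pderiv_C, pderiv_X_self, pderiv_X_of_ne hne1, pderiv_X_of_ne hnen,
        mul_one, mul_zero, zero_mul, add_zero, zero_add, sub_zero, Nat.cast_ofNat, two_eq]
      ring
    rw [e1]
    simp only [map_add, map_mul, map_pow, rename_X, rename_C]
    ring
  have h := isRegular_away_X_hypersurface hh (some 0) φ₀ (fun Q hQ hX0 _ hhQ => ⟨⟨some 2, h2'⟩, fun hm => ?_⟩) pt hpt0
    (by
      rw [hren]
      simp only [map_sub, map_add, map_mul, map_pow, MvPolynomial.eval_X, MvPolynomial.eval_C, map_ofNat]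
      exact hpt) hu
  · rwa [hren] at h
  · rw [hpd] at hm
    exact hD Q hQ hX0 hhQ (mem_of_C_mul_mem h2 hm)

end Summit.ResolutionOfSingularities.ResolutionOfSingularities.Theorems.WildQuotientResolution.S1.FreeModel

end
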